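import Summits.ResolutionOfSingularities.ResolutionOfSingularities.Theorems.EquisingularLiftEquisingularLiftNatCarrierStrictTransformChart
import Summits.ResolutionOfSingularities.ResolutionOfSingularities.Theorems.EquisingularLiftEquisingularLiftNatCarrierDeltaStalks
import HarnessLib

/-!
# [OURS · L1 W4.5(b) · EL♮(3)] T-M1-SCHEME part 3: the STALKS of the in-carrier centre `St(𝓢) ⊔ St(K)` at the points of the
# blow-up, read on the chart algebras — and `St(𝓢) ⊔ St(K) = St(𝓢 ⊔ K)` there (the carrier sup is the strict transform of `D`)

Crux `EquisingularLiftNat` = stmt-ResolutionOfSingularities-20038 (child EL♮(3) = stmt-ResolutionOfSingularities-20148), route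
EquisingularLift, line `sections`; registered stubs `stub_elnat_tcDeltaPointResolution` / `stub_elnat_three_isolated_nontc`
(skeleton v6), draft stub `stub_elnat_tcPlusPointResolution` (TARGET-TCPLUS, DESIGN v6/v7 (TC⁺)). Helper file
`--supports stmt-ResolutionOfSingularities-20148 --as helper` by res-L1-w45b-stub-1 (object T-M1-SCHEME part 3, res-L1-w45b-lead-2
GO 2026-08-27T09:23:39Z). HONEST FRAMING: OURS (cell res-hironaka, slot W4.5(b)); NOT a statement of any manuscript; AI-written,
weaker than expert review. No `sorry`; standard axioms.

THE IN-CARRIER CENTRE (no new definition): for a blow-up `τ : X' → X` along `J` (`IsBlowup τ J`), a CARRIER ideal sheaf `𝓢`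
(a regular divisor through the centre) and a hypersurface `K`, the ideal sheaf `strictTransformIdeal τ J 𝓢 ⊔ strictTransformIdeal τ J K`
of `X'` — by part 2 (…NatCarrierStrictTransformChart, ring core) it IS the strict transform of `D = V(𝓢) ∩ V(K)` wherever the
hypotheses below hold; in DESIGN v6 (TC⁺) `D = E ∩ V(K₁)` is the Δ-surface inside the point-carrier and `St(D)` the centre after
the in-carrier section blow-up.

* **`exists_stalk_carrierStrictTransform`** — at a point `x'` with `τ x' = p ∈ supp J` and `x' ∈ supp St(𝓢)` (the only points
  of the centre), under the CARRIER CONE PACK at `R = 𝒪_{X,p}`: `J_p = (c₀, c₁, …, c_r)` with `c` quasi-regular and `R/(c)` a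
  domain, `𝓢_p = (c₀)`, `K_p = (Φ(c₁, …, c_r))` for a FORM `Φ ∈ R[T₁, …, T_r]` of degree `d` with `Φ̄ ≠ 0`, and the reduced tail
  `c̄′ = c′ mod c₀` quasi-regular in `R/(c₀)`: in the chart-algebra presentation `𝒪_{X',x'} ≅ R[I/c_j]_𝔔` of res-L1-w45b-stub-2's
  dictionary (p506193) the chart index is `j = j′ + 1 ≠ 0`, and
  `E_{x'} = (χ t)`, **`St(𝓢)_{x'} = (χ e₀)`**, **`St(K)_{x'} = (χ Φ(e′))`**, **`St(𝓢 ⊔ K)_{x'} = (χ e₀) + (χ Φ(e′)) = St(𝓢)_{x'} ⊔ St(K)_{x'}`**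
  (`e₀ = c₀/c_j`, `e′_l = c_{l+1}/c_j`), and **`x' ∈ supp (St(𝓢) ⊔ St(K)) ↔ Φ(e′) ∈ 𝔔`** — res-type-100's F2 stalk theorem
  (`exists_stalk_strictTransformIdeal_sup_comap`, p509910) for the two cones `X₀` and `rename succ Φ` in ONE presentation, plus
  part 2's `iSup_colon_carrier_sup_eq_localization` for the sum;
* `stalkIdeal_strictTransformIdeal_sup_eq_sup` — the equation `St(𝓢 ⊔ K)_{x'} = St(𝓢)_{x'} ⊔ St(K)_{x'}` on its own (at such `x'`).

Consumers: `IsRegular`/`Flat` of the centre at `x'` are then ring facts on `R[I/c_j]_𝔔/(e₀, Φ(e′)) ≅ ((R/c₀)[Ī′/c̄_j′]/(Φ̄(ē′)))_𝔔̄`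
(part 2 `ker_blowupAlgebraMap_carrier`; res-L1-w45b-stub-3 p515745 (iv) regularity transfer; res-L1-w45b-stub-1 T-M1-FLAT p517580).

References: The Stacks Project, Tags 0804, 080C; U. Görtz, T. Wedhorn, *Algebraic Geometry I* (2020), (13.19). Tree inputs: p506193,
p508912 (…NatConeChart), p509910 (…NatCarrierDeltaStalks), part 2 (…NatCarrierStrictTransformChart).
-/

set_option linter.dupNamespace false -- mandated namespace `Summit.<Summit>.<Problem>` of this single-conjunct summit

noncomputable section

open CategoryTheory AlgebraicGeometry TopologicalSpace IsLocalRing MvPolynomial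
open Literature.AlgebraicGeometry.Resolution

namespace Summit.ResolutionOfSingularities.ResolutionOfSingularities.Cruxes.EquisingularLiftNat.Sections

universe u

variable {X X' : Scheme.{u}} {τ : X' ⟶ X} {J : X.IdealSheafData}

/-- The reduced form of the carrier's «cone» `T₀`, dehomogenised on any chart, is non-zero over a domain. [folklore] -/
theorem map_dehomogenize_X_zero_ne_zero {R : Type u} [CommRing R] {r : ℕ} (c : Fin (r + 1) → R)
    [IsDomain (R ⧸ Ideal.span (Set.range c))] (j : Fin (r + 1)) :
    MvPolynomial.map (Ideal.Quotient.mk (Ideal.span (Set.range c))) (dehomogenize j (MvPolynomial.X 0 : MvPolynomial (Fin (r + 1)) R)) ≠ 0 := by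
  classical
  rw [map_dehomogenize, MvPolynomial.map_X]
  exact dehomogenize_ne_zero_of_isHomogeneous j (isHomogeneous_X _ 0) (MvPolynomial.X_ne_zero 0)

/-- The reduced form of `rename succ Φ`, dehomogenised on any chart, is non-zero when `Φ̄ ≠ 0` (`Φ` a form). [folklore] -/
theorem map_dehomogenize_rename_succ_ne_zero {R : Type u} [CommRing R] {r : ℕ} (c : Fin (r + 1) → R) (j : Fin (r + 1))
    {d : ℕ} {Φ : MvPolynomial (Fin r) R} (hΦd : Φ.IsHomogeneous d)
    (hΦ : MvPolynomial.map (Ideal.Quotient.mk (Ideal.span (Set.range c))) Φ ≠ 0) :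
    MvPolynomial.map (Ideal.Quotient.mk (Ideal.span (Set.range c))) (dehomogenize j (rename Fin.succ Φ)) ≠ 0 := by
  classical
  rw [map_dehomogenize, MvPolynomial.map_rename]
  refine dehomogenize_ne_zero_of_isHomogeneous j ((hΦd.map _).rename_isHomogeneous) fun h => hΦ ?_
  exact MvPolynomial.rename_injective _ (Fin.succ_injective r) (h.trans (map_zero (rename Fin.succ)).symm)

set_option maxHeartbeats 1600000 in -- chart algebra `blowupAlgebra` = subalgebra of a localisation: slow unification (as p509910)
/-- **THE STALKS OF THE IN-CARRIER CENTRE `St(𝓢) ⊔ St(K)`.** See the module docstring. [cite: StacksProject, Tag 0804]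
[cite: GortzWedhorn2020, (13.19) p. 414] [OURS · L1 W4.5b] T-M1-SCHEME part 3 toward `stub_elnat_three_isolated_nontc` /
`stub_elnat_tcPlusPointResolution`; NOT a statement of the manuscript. -/
theorem exists_stalk_carrierStrictTransform [IsLocallyNoetherian X'] (hτ : IsBlowup τ J)
    (𝓢 K : X.IdealSheafData) (x' : X') (hx' : τ x' ∈ (J.support : Set X)) {r : ℕ}
    (c : Fin (r + 1) → X.presheaf.stalk (τ x')) (hcJ : Ideal.span (Set.range c) = stalkIdeal J (τ x'))
    (hc : IsQuasiRegular c) [IsDomain (X.presheaf.stalk (τ x') ⧸ Ideal.span (Set.range c))]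
    (hcb : IsQuasiRegular fun l : Fin r => Ideal.Quotient.mk (Ideal.span {c 0}) (c l.succ))
    (h𝓢 : stalkIdeal 𝓢 (τ x') = Ideal.span {c 0})
    {d : ℕ} (Φ : MvPolynomial (Fin r) (X.presheaf.stalk (τ x'))) (hΦd : Φ.IsHomogeneous d)
    (hΦ : MvPolynomial.map (Ideal.Quotient.mk (Ideal.span (Set.range c))) Φ ≠ 0)
    (hK : stalkIdeal K (τ x') = Ideal.span {MvPolynomial.eval (fun l => c l.succ) Φ})
    (hx'S : x' ∈ (strictTransformIdeal τ J 𝓢).support) :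
    ∃ (j' : Fin r) (𝔔 : PrimeSpectrum (blowupAlgebra (Ideal.span (Set.range c)) (c j'.succ)))
      (χ : blowupAlgebra (Ideal.span (Set.range c)) (c j'.succ) →+* X'.presheaf.stalk x')
      (e : X'.presheaf.stalk x' ≃+* Localization.AtPrime 𝔔.asIdeal),
      (∀ a, χ (algebraMap _ _ a) = (τ.stalkMap x').hom a) ∧
      (∀ b, e (χ b) = algebraMap _ (Localization.AtPrime 𝔔.asIdeal) b) ∧
      𝔔.asIdeal.comap (algebraMap _ (blowupAlgebra (Ideal.span (Set.range c)) (c j'.succ))) =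
        maximalIdeal (X.presheaf.stalk (τ x')) ∧
      stalkIdeal (J.comap τ) x' =
        Ideal.span {χ (algebraMap _ (blowupAlgebra (Ideal.span (Set.range c)) (c j'.succ)) (c j'.succ))} ∧
      stalkIdeal (strictTransformIdeal τ J 𝓢) x' = Ideal.span {χ (blowupAlgebra.frac c j'.succ 0)} ∧
      stalkIdeal (strictTransformIdeal τ J K) x' =
        Ideal.span {χ (MvPolynomial.aeval (fun l => blowupAlgebra.frac c j'.succ l.succ) Φ)} ∧
      stalkIdeal (strictTransformIdeal τ J (𝓢 ⊔ K)) x' =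
        Ideal.span {χ (blowupAlgebra.frac c j'.succ 0)} ⊔
          Ideal.span {χ (MvPolynomial.aeval (fun l => blowupAlgebra.frac c j'.succ l.succ) Φ)} ∧
      (x' ∈ (strictTransformIdeal τ J 𝓢 ⊔ strictTransformIdeal τ J K).support ↔
        MvPolynomial.aeval (fun l => blowupAlgebra.frac c j'.succ l.succ) Φ ∈ 𝔔.asIdeal) := by
  classical
  obtain ⟨jj, 𝔔, χ, e, hχ, he, h𝔔⟩ :=
    exists_blowupAlgebra_stalk_ringEquiv_of_eq hτ x' c (Ideal.span (Set.range c)) rfl hcJ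
  -- the chart index is not the carrier's: on the chart `j = 0` the fraction `c₀/c₀ = 1` would lie in `𝔔`
  have ht𝔔 : algebraMap _ (blowupAlgebra (Ideal.span (Set.range c)) (c jj)) (c jj) ∈ 𝔔.asIdeal := by
    rw [← Ideal.mem_comap, h𝔔]
    have h := (mem_support_iff_stalkIdeal_le J (τ x')).mp hx'
    rw [← hcJ] at h
    exact h (Ideal.subset_span (Set.mem_range_self _))
  letI := χ.toAlgebra
  haveI : IsLocalization.AtPrime (X'.presheaf.stalk x') 𝔔.asIdeal := isLocalization_stalk_of_ringEquiv 𝔔 x' χ e he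
  have hstalkMap : (τ.stalkMap x').hom = χ.comp (algebraMap _ (blowupAlgebra (Ideal.span (Set.range c)) (c jj))) :=
    RingHom.ext fun a => (hχ a).symm
  -- the stalk of the exceptional ideal
  have hE : stalkIdeal (J.comap τ) x' =
      Ideal.span {χ (algebraMap _ (blowupAlgebra (Ideal.span (Set.range c)) (c jj)) (c jj))} := by
    rw [stalkIdeal_comap_eq_map_stalkMap, ← hcJ, hstalkMap, ← Ideal.map_map,
      map_blowupAlgebra_eq_span (Ideal.subset_span (Set.mem_range_self jj)), Ideal.map_span, Set.image_singleton]
  -- the stalk of `St(𝓢)`: the carrier is the «cone» `X₀` of degree one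
  have h𝓢' : stalkIdeal 𝓢 (τ x') =
      Ideal.span {MvPolynomial.eval c (MvPolynomial.X 0 : MvPolynomial (Fin (r + 1)) (X.presheaf.stalk (τ x')))} := by
    rw [h𝓢, MvPolynomial.eval_X]
  have hSt𝓢 : stalkIdeal (strictTransformIdeal τ J 𝓢) x' = Ideal.span {χ (blowupAlgebra.frac c jj 0)} := by
    have h := iSup_colon_span_eval_eq_span_coneTransform_localization c jj hc (isHomogeneous_X _ 0)
      (map_dehomogenize_X_zero_ne_zero c jj) 𝔔.asIdeal.primeCompl (X'.presheaf.stalk x')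
    rw [MvPolynomial.aeval_X] at h
    rw [stalkIdeal_strictTransformIdeal, hE, h𝓢', Ideal.map_span, Set.image_singleton, hstalkMap]
    exact h
  have he₀ : blowupAlgebra.frac c jj 0 ∈ 𝔔.asIdeal := by
    have h := (mem_support_iff_stalkIdeal_le _ _).mp hx'S
    rw [hSt𝓢, Ideal.span_singleton_le_iff_mem, mem_maximalIdeal_iff_of_stalk_ringEquiv 𝔔 x' χ e he] at h
    exact h
  have hjj : jj ≠ 0 := by
    rintro rfl
    have h1 : blowupAlgebra.frac c (0 : Fin (r + 1)) 0 = 1 := blowupAlgebra.gen_self _ _ _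
    rw [h1] at he₀
    exact 𝔔.isPrime.ne_top ((Ideal.eq_top_iff_one _).mpr he₀)
  obtain ⟨j', rfl⟩ := Fin.exists_succ_eq.mpr hjj
  -- the stalk of `St(K)`: the cone `rename succ Φ`
  have hStK : stalkIdeal (strictTransformIdeal τ J K) x' =
      Ideal.span {χ (MvPolynomial.aeval (fun l => blowupAlgebra.frac c j'.succ l.succ) Φ)} := by
    have h := iSup_colon_span_eval_eq_span_coneTransform_localization c j'.succ hc
      ((hΦd.rename_isHomogeneous (f := Fin.succ))) (map_dehomogenize_rename_succ_ne_zero c j'.succ hΦd hΦ)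
      𝔔.asIdeal.primeCompl (X'.presheaf.stalk x')
    rw [MvPolynomial.eval_rename, MvPolynomial.aeval_rename] at h
    rw [stalkIdeal_strictTransformIdeal, hE, hK, Ideal.map_span, Set.image_singleton, hstalkMap]
    exact h
  -- the stalk of `St(𝓢 ⊔ K)`: part 2's carrier sup in the localisation `𝒪_{X',x'}`
  have hSt : stalkIdeal (strictTransformIdeal τ J (𝓢 ⊔ K)) x' =
      Ideal.span {χ (blowupAlgebra.frac c j'.succ 0)} ⊔
        Ideal.span {χ (MvPolynomial.aeval (fun l => blowupAlgebra.frac c j'.succ l.succ) Φ)} := by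
    have h := (iSup_colon_carrier_sup_eq_localization c j' hc hcb hΦd hΦ 𝔔.asIdeal.primeCompl (X'.presheaf.stalk x')).2
    -- both `Ideal.map`s of sups of principal ideals, written as sups of principal ideals
    rw [Ideal.map_sup, Ideal.map_span, Ideal.map_span, Set.image_singleton, Set.image_singleton] at h
    rw [Ideal.map_sup, Ideal.map_span, Ideal.map_span, Set.image_singleton, Set.image_singleton] at h
    rw [stalkIdeal_strictTransformIdeal, hE, stalkIdeal_sup, h𝓢, hK, hstalkMap, ← Ideal.map_map, Ideal.map_sup, Ideal.map_span,
      Ideal.map_span, Set.image_singleton, Set.image_singleton, Ideal.map_sup, Ideal.map_span, Ideal.map_span,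
      Set.image_singleton, Set.image_singleton]
    exact h
  refine ⟨j', 𝔔, χ, e, hχ, he, h𝔔, hE, hSt𝓢, hStK, hSt, ?_⟩
  -- support
  rw [mem_support_iff_stalkIdeal_le, stalkIdeal_sup, hSt𝓢, hStK, sup_le_iff, Ideal.span_singleton_le_iff_mem,
    Ideal.span_singleton_le_iff_mem, mem_maximalIdeal_iff_of_stalk_ringEquiv 𝔔 x' χ e he,
    mem_maximalIdeal_iff_of_stalk_ringEquiv 𝔔 x' χ e he]
  exact ⟨fun h => h.2, fun h => ⟨he₀, h⟩⟩

/-- **`St(𝓢 ⊔ K) = St(𝓢) ⊔ St(K)` on stalks** at the points of `supp St(𝓢)` over `supp J`, under the carrier cone pack: the sum of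
the strict transforms of the carrier and of the hypersurface IS the strict transform of their intersection `D` (no further
saturation) — part 2's chart statement read in `𝒪_{X',x'}`. [cite: StacksProject, Tag 080C] -/
theorem stalkIdeal_strictTransformIdeal_sup_eq_sup [IsLocallyNoetherian X'] (hτ : IsBlowup τ J)
    (𝓢 K : X.IdealSheafData) (x' : X') (hx' : τ x' ∈ (J.support : Set X)) {r : ℕ}
    (c : Fin (r + 1) → X.presheaf.stalk (τ x')) (hcJ : Ideal.span (Set.range c) = stalkIdeal J (τ x'))
    (hc : IsQuasiRegular c) [IsDomain (X.presheaf.stalk (τ x') ⧸ Ideal.span (Set.range c))]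
    (hcb : IsQuasiRegular fun l : Fin r => Ideal.Quotient.mk (Ideal.span {c 0}) (c l.succ))
    (h𝓢 : stalkIdeal 𝓢 (τ x') = Ideal.span {c 0})
    {d : ℕ} (Φ : MvPolynomial (Fin r) (X.presheaf.stalk (τ x'))) (hΦd : Φ.IsHomogeneous d)
    (hΦ : MvPolynomial.map (Ideal.Quotient.mk (Ideal.span (Set.range c))) Φ ≠ 0)
    (hK : stalkIdeal K (τ x') = Ideal.span {MvPolynomial.eval (fun l => c l.succ) Φ})
    (hx'S : x' ∈ (strictTransformIdeal τ J 𝓢).support) :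
    stalkIdeal (strictTransformIdeal τ J (𝓢 ⊔ K)) x' =
      stalkIdeal (strictTransformIdeal τ J 𝓢) x' ⊔ stalkIdeal (strictTransformIdeal τ J K) x' := by
  obtain ⟨j', 𝔔, χ, e, -, -, -, -, hSt𝓢, hStK, hSt, -⟩ :=
    exists_stalk_carrierStrictTransform hτ 𝓢 K x' hx' c hcJ hc hcb h𝓢 Φ hΦd hΦ hK hx'S
  rw [hSt, hSt𝓢, hStK]

end Summit.ResolutionOfSingularities.ResolutionOfSingularities.Cruxes.EquisingularLiftNat.Sections

end
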